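import Summits.BirchSwinnertonDyer.BirchSwinnertonDyer.Theorems.ByReductionTypeAtTwoSupersingularFlatZetaF3AssemblyPowTwo
import HarnessLib

/-!
# Route `ByReductionTypeAtTwo` (rung K4), crux `SupersingularRankZeroAtTwo` (item stmt-BirchSwinnertonDyer-19097), line
# `odd_blind_package` v2.20, stub 2/5 `stub_flatPackage : FlatZetaPackageAtTwo` — **THE F3 SOCKETS OF THE ♭ ZETA PACKAGE**: t42's
# zeta-line assembly (Z6 ★★★ `SSFlatPackage.flatF3_package_of_levelCongruences`, Z7 `…_pow_two_…`) RE-KEYED to the registered f-block of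
# `FlatZetaPackageAtTwo` — no `P`, no `loc`, F3a as `∃ z ∈ Z, Col♭(L z) = G` — so that the capstone hand's last line is ONE `exact`
# (cell `bsd-2adic`, seat `bsd-2adic-ss-1` GEN 26 = LEAD of 19097; `--supports 19097`, helper)

HONEST FRAMING (D-0054): THEOREMS ONLY — no definition, no named fact, no instance, no notation, no `sorry`.  SOCKET file: pure
re-keying of landed consumers; the levelwise congruences `hE3` (tower-1 E5 ★★★ `SSFlatERL.flat_levelCongruences_of_C6` per cusp datum),
the coprime family of genuine Euler classes `hcop`, the multiplier prime to `(2)` (`h2`) and the integrality datum `t` stay DISPLAYED.  Closes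
NO stub; 19097 stays OPEN on its 5 registered stubs (v2.20 39efd4f3); nothing booked; BSD₂ is proved for no supersingular curve and BSD for
no curve by any of this; typed ≠ proved.

## What and why

v2.20 folded the ♭ Poitou–Tate exactness out of stub 2 (★★ p837143); the registered type `FlatZetaPackageAtTwo` now asks, at a Honda system
`(cneg, c)` and for EVERY pin `I`, `pairFun`-pinned `L`, Coleman-pinned `J`:
`∃ (Z : Submodule Λ I.H) (G : Λ), (∃ z ∈ Z, (J (L z)).2 = G) ∧ ι G = C ϖ · ι L♭ ∧ ZL2`.
t42 GEN 51 stated its F3 consumers for ANY `P`, `loc` with `(loc x : Λ) = (J (L x)).2` and concluded `G ∈ Submodule.map (P.subtype ∘ₗ loc) Z`.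
Taking `P := ⊤`, `loc :=` the corestriction of `LinearMap.snd ∘ₗ J ∘ₗ L` (the F1♭ witness of p837143) and unpacking `Submodule.mem_map`
gives the registered F3a on the nose.
* §1 ★ `flatZeta_fblock_of_levelCongruences` — EXACT form (Z6): inputs `hrank`, `hLf`, the family `x`/`A`, `d ≠ 0`, `hE3`, `hcop`, `h2`,
  `t = ϖ·d ∈ ℤ₂`; output LITERALLY the f-block body of `FlatZetaPackageAtTwo` at `(I, L, J)`.
* §2 `flatZeta_fblock_pow_two_of_levelCongruences` — SLACK form (Z7, no `h2`): the same with `∃ k` and `ι G = C(2^k)·C ϖ·ι L♭` — OPTION text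
  for the LEAD's 2-power statement question; it is NOT the registered F3b and substitutes for nothing.

References: [Kato2004Asterisque] Thm. 12.5 (1)(4), §13.9, §13.12–13.14 (pp. 230–234); [Sprung2012] Def. 7.1 (p. 1500), Thm. 7.14, 7.16;
[Sprung2017] Thm. 1.12, Cor. 4.4–4.5; [Kobayashi2003] Thm. 6.3.
-/

set_option autoImplicit false
-- the Theorems namespace of this sub repeats the summit name by design (D-0017 nested layout)
set_option linter.dupNamespace false

noncomputable section

open scoped Classical NumberField

open Polynomial

namespace Summit.BirchSwinnertonDyer.BirchSwinnertonDyer.Theorems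

namespace SSFlatFold

open NumberField IsDedekindDomain WeierstrassCurve Literature.NumberTheory.EllipticCurves
  Literature.NumberTheory.EllipticCurves.ZpExtension Literature.NumberTheory.EllipticCurves.Sprung2017
  Literature.NumberTheory.EllipticCurves.Kobayashi2003 Literature.NumberTheory.EllipticCurves.Sprung2012
  Literature.NumberTheory.EllipticCurves.Rank1Residual Literature.NumberTheory.GaloisRepresentations CongruenceSubgroup

variable (W : WeierstrassCurve ℚ) [W.IsElliptic] [W.IsGloballyMinimal] [ContinuousSMul ℤ_[2] (W.tateModule 2)]
  [Module.Free ℤ_[2] (W.tateModule 2)] [Module.Finite ℤ_[2] (W.tateModule 2)]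
  {κ : ZpExtension ℚ 2} {γ : Field.absoluteGaloisGroup ℚ} (v : HeightOneSpectrum (𝓞 ℚ))
  {g : Field.absoluteGaloisGroup (v.adicCompletion ℚ)} {c : ℕ → localPoints W (v.adicCompletion ℚ)}

/-- The corestriction `loc : I.H →ₗ ⊤` of `Col♭ ∘ L = LinearMap.snd ∘ₗ J ∘ₗ L` has the value dictionary `(loc x : Λ) = (J (L x)).2`, and
membership of `G` in `loc(Z)` read through `(⊤).subtype` is `∃ z ∈ Z, (J (L z)).2 = G`. [folklore] -/
theorem exists_mem_snd_eq_of_mem_map_codRestrict {R : Type*} [CommRing R] {H F : Type*} [AddCommGroup H] [Module R H]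
    [AddCommGroup F] [Module R F] (L : H →ₗ[R] F) (J : F →ₗ[R] R × R) (Z : Submodule R H) (G : R)
    (hG : G ∈ Submodule.map ((⊤ : Submodule R R).subtype ∘ₗ
      LinearMap.codRestrict (⊤ : Submodule R R) ((LinearMap.snd R R R) ∘ₗ J ∘ₗ L) (fun _ ↦ Submodule.mem_top)) Z) :
    ∃ z ∈ Z, (J (L z)).2 = G := by
  obtain ⟨z, hz, hzG⟩ := Submodule.mem_map.1 hG
  exact ⟨z, hz, hzG⟩

/-! ## §1 The exact socket (Z6 re-keyed) -/

/-- ★ **THE F3 SOCKET OF `FlatZetaPackageAtTwo` (exact form).**  At a Honda-type datum `(g, c)` (Coleman values through `J`, `hJ`), for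
EVERY pin `I` of rank `≤ 1`, `Λ`-linear localisation `L` and `Λ`-linear joint Coleman family `J`: from a family `x_i ∈ 𝐇¹` with multipliers
`A_i`, a common denominator `d ≠ 0`, the LEVELWISE CONGRUENCES `hE3` («`A_i·θ_n ≡ d·P_{n,c_n}(L x_i)` mod `ω_n`, up to `2^m`, in `Λ ⊗ ℚ₂`» —
tower-1 E5 per cusp datum), coprimality of the `A_i` with genuine non-zero Euler classes at every height-one `𝔭 ∌ 2` (`hcop`), a multiplier
prime to `(2)` (`h2`), `L♭ ≠ 0` and `t = ϖ·d ∈ ℤ₂`: LITERALLY the f-block body of the registered `FlatZetaPackageAtTwo` —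
`∃ Z G, (∃ z ∈ Z, (J (L z)).2 = G) ∧ ι G = C ϖ · ι L♭ ∧ ZL2`.  ONE call of t42's ★★★ `SSFlatPackage.flatF3_package_of_levelCongruences` at
`P := ⊤`, `loc := codRestrict ⊤ (LinearMap.snd ∘ₗ J ∘ₗ L)`. [cite: Kato2004Asterisque, Thm. 12.5 (1)(4), §13.9 (p. 230), §13.12–13.14 (pp. 231–234)]
[cite: Sprung2012, Def. 7.1 (p. 1500), Thm. 7.14, 7.16] [cite: Sprung2017, Thm. 1.12, Cor. 4.4–4.5] -/
theorem flatZeta_fblock_of_levelCongruences (hss : GoodSS W 2) (hκ : κ.IsCyclotomic) (hγ : κ.IsTopGenerator γ)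
    (hg : κ.IsTopGenerator (resGalOfEmb (closureEmb (K := ℚ) (v.adicCompletion ℚ)) g)) {ap : ℤ} (hap : (2 : ℤ) ∣ ap)
    (I : Kato2004.IwasawaH1Data W 2 κ γ) (hrank : Module.rank (IwasawaAlgebra 2) I.H ≤ 1)
    (L : letI := moduleOfGenerator κ (closureEmb (K := ℚ) (v.adicCompletion ℚ)) W hg
      I.H →ₗ[IwasawaAlgebra 2] (localTowerPointsOfEmb κ (closureEmb (K := ℚ) (v.adicCompletion ℚ)) W →+ ℤ_[2]))
    (J : letI := moduleOfGenerator κ (closureEmb (K := ℚ) (v.adicCompletion ℚ)) W hg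
      (localTowerPointsOfEmb κ (closureEmb (K := ℚ) (v.adicCompletion ℚ)) W →+ ℤ_[2]) →ₗ[IwasawaAlgebra 2]
        IwasawaAlgebra 2 × IwasawaAlgebra 2)
    (hJ : ∀ w, IsColemanPair κ (closureEmb (K := ℚ) (v.adicCompletion ℚ)) W ap g c w (J w).1 (J w).2)
    {N : ℕ} (f : CuspForm (Gamma0 N) 2) (ϖ : ℚ) (Ls Lf : IwasawaAlgebra 2) (hL : IsSprungPair f 2 ap Ls Lf) (hLf : Lf ≠ 0)
    {ι : Type*} (x : ι → I.H) (A : ι → IwasawaAlgebra 2) {d : ℤ_[2]} (hd : d ≠ 0)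
    (hE3 : ∀ (i : ι) (n : ℕ), ∃ (m : ℕ) (q : IwasawaAlgebra 2), PowerSeries.C ((2 : ℚ_[2]) ^ m) *
        (iwasawaToPowerSeries 2 (A i) * (((mazurTateElement f 2 n).map (algebraMap ℚ ℚ_[2]) : ℚ_[2][X]) : PowerSeries ℚ_[2]) -
          iwasawaToPowerSeries 2 (PowerSeries.C d *
            pairingSum W (localTowerPointsOfEmb κ (closureEmb (K := ℚ) (v.adicCompletion ℚ)) W) g n (c n) (L (x i)))) =
      iwasawaToPowerSeries 2 ((((cyclotomicOmega 2 n).map (Int.castRingHom ℤ_[2]) : ℤ_[2][X]) : PowerSeries ℤ_[2]) * q))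
    (hcop : ∀ 𝔭 : PrimeSpectrum (IwasawaAlgebra 2), 𝔭.asIdeal.height = 1 →
      PowerSeries.C (2 : ℤ_[2]) ∉ 𝔭.asIdeal → ∃ i, A i ∉ 𝔭.asIdeal ∧
        Literature.NumberTheory.EllipticCurves.Kato2004.IsEulerSystemClassTwo W hκ I (x i) ∧ x i ≠ 0)
    (h2 : ∀ 𝔭 : PrimeSpectrum (IwasawaAlgebra 2), 𝔭.asIdeal.height = 1 →
      PowerSeries.C (2 : ℤ_[2]) ∈ 𝔭.asIdeal → ∃ i, A i ∉ 𝔭.asIdeal)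
    (t : ℤ_[2]) (ht : (t : ℚ_[2]) = (ϖ : ℚ_[2]) * (d : ℚ_[2])) :
    ∃ (Z : Submodule (IwasawaAlgebra 2) I.H) (G : IwasawaAlgebra 2),
      (∃ z ∈ Z, (J (L z)).2 = G) ∧
      iwasawaToPowerSeries 2 G = PowerSeries.C (ϖ : ℚ_[2]) * iwasawaToPowerSeries 2 Lf ∧
      (∃ s₀ : I.H, Z = Submodule.span (IwasawaAlgebra 2) {s₀} ∧
        ∀ 𝔭 : PrimeSpectrum (IwasawaAlgebra 2), 𝔭.asIdeal.height = 1 →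
          PowerSeries.C (2 : ℤ_[2]) ∉ 𝔭.asIdeal →
          ∃ (M : IwasawaAlgebra 2) (s : I.H), M ∉ 𝔭.asIdeal ∧
            Literature.NumberTheory.EllipticCurves.Kato2004.IsEulerSystemClassTwo W hκ I s ∧ s ≠ 0 ∧
            M • s₀ = s) := by
  letI := moduleOfGenerator κ (closureEmb (K := ℚ) (v.adicCompletion ℚ)) W hg
  obtain ⟨Z, G, hG, hF3b, hZL⟩ := SSFlatPackage.flatF3_package_of_levelCongruences W v hss hκ hγ hg hap I hrank L J hJ ⊤
    (LinearMap.codRestrict (⊤ : Submodule (IwasawaAlgebra 2) (IwasawaAlgebra 2))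
      ((LinearMap.snd (IwasawaAlgebra 2) (IwasawaAlgebra 2) (IwasawaAlgebra 2)) ∘ₗ J ∘ₗ L) (fun _ ↦ Submodule.mem_top))
    (fun _ ↦ rfl) f ϖ Ls Lf hL hLf x A hd hE3 hcop h2 t ht
  exact ⟨Z, G, exists_mem_snd_eq_of_mem_map_codRestrict L J Z G hG, hF3b, hZL⟩

/-! ## §2 The slack socket (Z7 re-keyed; OPTION text) -/

/-- **THE F3 SOCKET, `2`-POWER SLACK FORM** (no `h2`): the same inputs without a multiplier prime to `(2)` give the f-block with
`ι G = C(2^k)·C ϖ·ι L♭` for SOME `k` — t42's Z7 at `P := ⊤`.  OPTION text for the LEAD's 2-power statement question; NOT the registered F3b.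
[cite: Kato2004Asterisque, Thm. 12.5 (4), §13.12 (pp. 231–233)] [cite: Sprung2012, Def. 7.1 (p. 1500), Thm. 7.14, 7.16] -/
theorem flatZeta_fblock_pow_two_of_levelCongruences (hss : GoodSS W 2) (hκ : κ.IsCyclotomic) (hγ : κ.IsTopGenerator γ)
    (hg : κ.IsTopGenerator (resGalOfEmb (closureEmb (K := ℚ) (v.adicCompletion ℚ)) g)) {ap : ℤ} (hap : (2 : ℤ) ∣ ap)
    (I : Kato2004.IwasawaH1Data W 2 κ γ) (hrank : Module.rank (IwasawaAlgebra 2) I.H ≤ 1)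
    (L : letI := moduleOfGenerator κ (closureEmb (K := ℚ) (v.adicCompletion ℚ)) W hg
      I.H →ₗ[IwasawaAlgebra 2] (localTowerPointsOfEmb κ (closureEmb (K := ℚ) (v.adicCompletion ℚ)) W →+ ℤ_[2]))
    (J : letI := moduleOfGenerator κ (closureEmb (K := ℚ) (v.adicCompletion ℚ)) W hg
      (localTowerPointsOfEmb κ (closureEmb (K := ℚ) (v.adicCompletion ℚ)) W →+ ℤ_[2]) →ₗ[IwasawaAlgebra 2]
        IwasawaAlgebra 2 × IwasawaAlgebra 2)
    (hJ : ∀ w, IsColemanPair κ (closureEmb (K := ℚ) (v.adicCompletion ℚ)) W ap g c w (J w).1 (J w).2)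
    {N : ℕ} (f : CuspForm (Gamma0 N) 2) (ϖ : ℚ) (Ls Lf : IwasawaAlgebra 2) (hL : IsSprungPair f 2 ap Ls Lf) (hLf : Lf ≠ 0)
    {ι : Type*} (x : ι → I.H) (A : ι → IwasawaAlgebra 2) {d : ℤ_[2]} (hd : d ≠ 0)
    (hE3 : ∀ (i : ι) (n : ℕ), ∃ (m : ℕ) (q : IwasawaAlgebra 2), PowerSeries.C ((2 : ℚ_[2]) ^ m) *
        (iwasawaToPowerSeries 2 (A i) * (((mazurTateElement f 2 n).map (algebraMap ℚ ℚ_[2]) : ℚ_[2][X]) : PowerSeries ℚ_[2]) -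
          iwasawaToPowerSeries 2 (PowerSeries.C d *
            pairingSum W (localTowerPointsOfEmb κ (closureEmb (K := ℚ) (v.adicCompletion ℚ)) W) g n (c n) (L (x i)))) =
      iwasawaToPowerSeries 2 ((((cyclotomicOmega 2 n).map (Int.castRingHom ℤ_[2]) : ℤ_[2][X]) : PowerSeries ℤ_[2]) * q))
    (hcop : ∀ 𝔭 : PrimeSpectrum (IwasawaAlgebra 2), 𝔭.asIdeal.height = 1 →
      PowerSeries.C (2 : ℤ_[2]) ∉ 𝔭.asIdeal → ∃ i, A i ∉ 𝔭.asIdeal ∧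
        Literature.NumberTheory.EllipticCurves.Kato2004.IsEulerSystemClassTwo W hκ I (x i) ∧ x i ≠ 0)
    (t : ℤ_[2]) (ht : (t : ℚ_[2]) = (ϖ : ℚ_[2]) * (d : ℚ_[2])) :
    ∃ (Z : Submodule (IwasawaAlgebra 2) I.H) (G : IwasawaAlgebra 2) (k : ℕ),
      (∃ z ∈ Z, (J (L z)).2 = G) ∧
      iwasawaToPowerSeries 2 G = PowerSeries.C ((2 : ℚ_[2]) ^ k) * PowerSeries.C (ϖ : ℚ_[2]) * iwasawaToPowerSeries 2 Lf ∧
      (∃ s₀ : I.H, Z = Submodule.span (IwasawaAlgebra 2) {s₀} ∧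
        ∀ 𝔭 : PrimeSpectrum (IwasawaAlgebra 2), 𝔭.asIdeal.height = 1 →
          PowerSeries.C (2 : ℤ_[2]) ∉ 𝔭.asIdeal →
          ∃ (M : IwasawaAlgebra 2) (s : I.H), M ∉ 𝔭.asIdeal ∧
            Literature.NumberTheory.EllipticCurves.Kato2004.IsEulerSystemClassTwo W hκ I s ∧ s ≠ 0 ∧
            M • s₀ = s) := by
  letI := moduleOfGenerator κ (closureEmb (K := ℚ) (v.adicCompletion ℚ)) W hg
  obtain ⟨Z, G, k, hG, hF3b, hZL⟩ := SSFlatPackage.flatF3_package_pow_two_of_levelCongruences W v hss hκ hγ hg hap I hrank L J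
    hJ ⊤ (LinearMap.codRestrict (⊤ : Submodule (IwasawaAlgebra 2) (IwasawaAlgebra 2))
      ((LinearMap.snd (IwasawaAlgebra 2) (IwasawaAlgebra 2) (IwasawaAlgebra 2)) ∘ₗ J ∘ₗ L) (fun _ ↦ Submodule.mem_top))
    (fun _ ↦ rfl) f ϖ Ls Lf hL hLf x A hd hE3 hcop t ht
  exact ⟨Z, G, k, exists_mem_snd_eq_of_mem_map_codRestrict L J Z G hG, hF3b, hZL⟩

end SSFlatFold

end Summit.BirchSwinnertonDyer.BirchSwinnertonDyer.Theorems

end
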